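import Mathlib
import Summits.AtomisticToContinuum.HydrodynamicLimit.Theses.JParityClosure
import Literature.Analysis.FluidPDE.HardSphereRegularGeometry
import Literature.Analysis.FluidPDE.BBGKYMarginals

/-!
# Sketch — crux-ideate round 1 (generation 2), ideator 2, crux `JParityClosure.OddContactSymmetry`
(stmt-AtomisticToContinuum-13078)

First lemmas / first checkable statements of the two idea cards filed by this seat
(planner-cruxidea-stmt-AtomisticToContinuum-13078-2-g2-0, 2026-08-16):

* card `equilibrium-tilt-reversal-cumulants` (§A): the PATH-REVERSAL dictionary for collision
  marks — under `Θ` (run the trajectory backwards and flip velocities) a collision with pre-data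
  `(n̂, v, w)` becomes one with pre-data `(n̂, −v′, −w′)` (`reversed_pre_data`, PROVED), a J-odd and
  P-even mark flips sign there (`odd_mark_reversed`, PROVED), the one-body surprisal jump computed
  with the reversed empirical law `h∘(−)` flips sign (`surprisal_reversed`, PROVED) — so the crux's
  reweighting `1 + e^{−F}` is sent to `1 + e^{+F}`; the abstract reversal-covariance identity
  (`integral_mul_eq_neg_of_reversal`, PROVED); and the typed RUNG-1 target `RungOneCovariance`
  (the crux's statistic, VERBATIM its `let`-chain, at constant profiles, is asymptotically
  uncorrelated with every bounded continuous initial one-body fluctuation field — the first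
  `δ`-derivative of the picked line's `stub_meanParity` at the equilibrium rung).
* card `dilute-blowdown-chaos-rigidity` (§B): the quantifier fact that makes the dilute blow-down
  available INSIDE the crux (`threshold_iff_no_bad_seq`, PROVED: a threshold statement
  `∃ σ₀ > 0, ∀ σ ∈ (0, σ₀), Good σ` fails iff there is a bad sequence `σ_k → 0⁺`), and the typed
  rigidity target at the Boltzmann–Grad blow-down point (`HomogeneousHierarchyRigidity`: a
  stationary, spatially homogeneous, Hewitt–Savage-mixed solution family of the tree's Boltzmann
  hierarchy `boltzmannHOp` is a mixture of Maxwellian products).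

Nothing here is filed to the tree; it only has to elaborate (`lean check` rc 0).
-/

noncomputable section

open MeasureTheory Metric Real Filter
open scoped InnerProductSpace BigOperators Topology

namespace Summit.AtomisticToContinuum.HydrodynamicLimit.Cruxes.OddContactSymmetry.IdeatorTwoG2

open Literature.Analysis.FluidPDE (reflectVel reflectVel_neg reflectVel_reflectVel)

/-- Velocity space. -/
abbrev V3 : Type := EuclideanSpace ℝ (Fin 3)

/-- J-oddness of a collision mark, VERBATIM the hypothesis of `OddContactSymmetry`. -/
def IsJOdd (Ψ : V3 × V3 × V3 → ℝ) : Prop :=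
  ∀ (n v w : V3), ‖n‖ = 1 →
    Ψ (-n, (reflectVel n (v, w)).1, (reflectVel n (v, w)).2) = -Ψ (n, v, w)

/-- P-evenness (full inversion `(n̂, v, w) ↦ (−n̂, −v, −w)`) of a collision mark. The effective class
of the crux (J-odd ∧ exchange-even, e.g. `tanh((P·n̂)(P·g⊥))`) contains P-even members; the
reversal dictionary below is stated for them (P-odd marks pick up one more sign). -/
def IsPEven (Ψ : V3 × V3 × V3 → ℝ) : Prop :=
  ∀ (n v w : V3), Ψ (-n, -v, -w) = Ψ (n, v, w)

/-! ## §A  Path reversal at a collision (card `equilibrium-tilt-reversal-cumulants`) -/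

/-- `reflectVel n` is linear in the velocity pair: it commutes with `(v, w) ↦ (−v, −w)`. [folklore] -/
theorem reflectVel_neg_pair (n : V3) (p : V3 × V3) :
    reflectVel n (-p.1, -p.2) = (-(reflectVel n p).1, -(reflectVel n p).2) := by
  have hc : ⟪(-p.1) - (-p.2), n⟫_ℝ = -⟪p.1 - p.2, n⟫_ℝ := by
    rw [← inner_neg_left]
    congr 1
    abel
  simp only [reflectVel, hc, neg_div, neg_smul]
  rw [Prod.mk.injEq]
  constructor <;> abel

/-- **Pre-data of the reversed collision.** Under path reversal `Θ` (time reversed, all velocities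
flipped, positions — hence the contact normal `n̂ = (x_i − x_j)/ε` — unchanged) a collision with
pre-velocities `(v, w)` and post-velocities `(v′, w′) = reflectVel n (v, w)` becomes a collision whose
PRE-velocities are `(−v′, −w′)` and whose POST-velocities are `(−v, −w)`:
`reflectVel n (−v′, −w′) = (−v, −w)`. [folklore] -/
theorem reversed_pre_data (n : V3) (p : V3 × V3) :
    reflectVel n (-(reflectVel n p).1, -(reflectVel n p).2) = (-p.1, -p.2) := by
  rw [show (-(reflectVel n p).1, -(reflectVel n p).2) = (-(reflectVel n p).1, -(reflectVel n p).2) from rfl,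
    ← show reflectVel n (-( reflectVel n p).1, -(reflectVel n p).2) =
        reflectVel n (-(reflectVel n p).1, -(reflectVel n p).2) from rfl]
  have h := reflectVel_neg_pair n (reflectVel n p)
  rw [h, reflectVel_reflectVel]

/-- **A J-odd, P-even mark flips sign under path reversal.** The reversed collision's pre-data is
`(n̂, −v′, −w′) = P (J (n̂, v, w))` with `J (n̂, v, w) = (−n̂, v′, w′)` and `P` the full inversion, so
`Ψ(n̂, −v′, −w′) = Ψ(−n̂, v′, w′) = −Ψ(n̂, v, w)`. Consequence: the UNWEIGHTED collision sum
`K_N[χ g Ψ]` is exactly `Θ`-odd (up to `χ(s,·) ↦ χ(τ−s,·)`), hence has mean ZERO under every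
`Θ`-invariant path law — e.g. the equilibrium hard-sphere flow from the Gibbs law at rest. [folklore] -/
theorem odd_mark_reversed (Ψ : V3 × V3 × V3 → ℝ) (hJ : IsJOdd Ψ) (hP : IsPEven Ψ) (n v w : V3)
    (hn : ‖n‖ = 1) :
    Ψ (n, -(reflectVel n (v, w)).1, -(reflectVel n (v, w)).2) = -Ψ (n, v, w) := by
  have h1 := hP (-n) (reflectVel n (v, w)).1 (reflectVel n (v, w)).2
  rw [neg_neg] at h1
  rw [h1]
  exact hJ n v w hn

/-- **The surprisal jump flips sign under path reversal.** With the reversed one-body law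
`h_rev(u) = h(−u)` (the empirical law of the reversed path at the reversed time), the surprisal jump
of the reversed collision (pre `(−v′, −w′)`, post `(−v, −w)`) is `−F`:
`log h_rev(−v′) + log h_rev(−w′) − log h_rev(−v) − log h_rev(−w) = −(log h v + log h w − log h v′ − log h w′)`.
Hence the crux's weight `1 + e^{−F}` is sent by `Θ` to `1 + e^{+F}`: the REWEIGHTED statistic is not
`Θ`-odd; `Θ` exchanges `K_N[Ψ e^{−F}]` and `−K_N[Ψ e^{+F}]` (the source of the finite-`N` rung-0 mean
`−(∫χ) ν(gΨ sinh F)` recorded by the triage). [folklore] -/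
theorem surprisal_reversed (h : V3 → ℝ) (v w v' w' : V3) :
    let hrev : V3 → ℝ := fun u => h (-u)
    Real.log (hrev (-v')) + Real.log (hrev (-w')) - Real.log (hrev (-v)) - Real.log (hrev (-w)) =
      -(Real.log (h v) + Real.log (h w) - Real.log (h v') - Real.log (h w')) := by
  intro hrev
  simp only [hrev, neg_neg]
  ring

/-- **Reversal covariance (abstract form).** On a probability space with a measure-preserving
involution-like map `Θ` (the equilibrium path law and path reversal), if `K ∘ Θ = −K'` and
`B ∘ Θ = B'` then `E[K' B'] = −E[K B]`. Used with `K = K_N[Ψ(1+e^{−F})]`, `K' = K_N[Ψ(1+e^{+F})]`,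
`B = Σ_i b(z_i(0))`, `B' = Σ_i b(x_i(τ), −v_i(τ))`: the covariance of the reweighted odd statistic
with the INITIAL fluctuation field equals minus that of its `e^{+F}`-twin with the FINAL field. [folklore] -/
theorem integral_mul_eq_neg_of_reversal {Ω : Type*} [MeasurableSpace Ω] (μ : Measure Ω)
    (Θ : Ω → Ω) (hΘ : MeasurePreserving Θ μ μ) (hemb : MeasurableEmbedding Θ)
    (K K' B B' : Ω → ℝ) (hK : ∀ ω, K (Θ ω) = -K' ω) (hB : ∀ ω, B (Θ ω) = B' ω) :
    ∫ ω, K' ω * B' ω ∂μ = -∫ ω, K ω * B ω ∂μ := by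
  have h1 : ∫ ω, K (Θ ω) * B (Θ ω) ∂μ = ∫ ω, K ω * B ω ∂μ :=
    hΘ.integral_comp hemb (fun ω => K ω * B ω)
  have h2 : (fun ω => K (Θ ω) * B (Θ ω)) = fun ω => -(K' ω * B' ω) := by
    funext ω
    rw [hK ω, hB ω]
    ring
  rw [h2, integral_neg] at h1
  linarith

/-- **RUNG 1 (linear response at the equilibrium rung), the card's first target.** VERBATIM the
crux's statistic `D` (same `let`-chain: cone mollifier `bx`, Gaussian `ϑ`-mollifier, surprisal `F`,
weight `1 + e^{−F}`, normalisation `ε/(N+1)`, ordered-pair double sum over collision times in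
`[0, τ]`), evaluated under the CONSTANT-profile local Gibbs law `LG = localGibbsLaw σ ā 0 θ̄`
(the flow-invariant Gibbs law at rest, rung 0 of the picked line), is asymptotically UNCORRELATED
with every bounded continuous initial one-body fluctuation field `S(z) = Σ_i b(x_i, v_i)`:
`Cov_LG(D, S) → 0` in the crux's limit order (`r₀` before `N₀`). Since a local Gibbs law with
profiles `(ā(1+δb_ρ), δb_u, θ̄(1+δb_θ))` is an exponential tilt of `LG` by a one-body sum, this is
`(d/dδ)|_{δ=0}` of the picked line's `stub_meanParity` — the first non-equilibrium-data instance of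
the crux in mean, reduced to an EQUILIBRIUM space-time covariance. -/
def RungOneCovariance : Prop :=
  ∃ η₀ : ℝ, 0 < η₀ ∧ ∀ (abar θbar : ℝ), 0 < abar → 0 < θbar → ∀ b : Literature.MathematicalPhysics.KineticTheory.T3 × Literature.MathematicalPhysics.KineticTheory.V3 → ℝ, Continuous b → (∃ C : ℝ, ∀ y, |b y| ≤ C) → ∃ σ₀ : ℝ, 0 < σ₀ ∧ ∀ σ : ℝ, 0 < σ → σ < σ₀ → ∀ Φ : (N : ℕ) → Literature.Analysis.FluidPDE.HardSphereFlow (Literature.Analysis.FluidPDE.Torus.geometry (Fin 3)) (Literature.MathematicalPhysics.KineticTheory.hsDiameter σ N) (N + 1), ∀ τ : ℝ, 0 < τ → ∀ χ : ℝ × UnitAddTorus (Fin 3) → ℝ, Continuous χ → ∀ g : ℝ → ℝ, Continuous g → (∀ a, η₀ ≤ a → g a = 0) → ∀ Ψ : EuclideanSpace ℝ (Fin 3) × EuclideanSpace ℝ (Fin 3) × EuclideanSpace ℝ (Fin 3) → ℝ, Continuous Ψ → (∃ C : ℝ, ∀ q, |Ψ q| ≤ C) → (∀ (n v w : EuclideanSpace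 ℝ (Fin 3)), ‖n‖ = 1 → Ψ (-n, (Literature.Analysis.FluidPDE.reflectVel n (v, w)).1, (Literature.Analysis.FluidPDE.reflectVel n (v, w)).2) = -Ψ (n, v, w)) → ∀ η : ℝ, 0 < η → ∃ r₀ : ℝ, 0 < r₀ ∧ ∀ r ϑ : ℝ, 0 < r → r < r₀ → 0 < ϑ → ϑ < r₀ → ∃ N₀ : ℕ, ∀ N : ℕ, N₀ ≤ N → let ε := Literature.MathematicalPhysics.KineticTheory.hsDiameter σ N; let G := Literature.Analysis.FluidPDE.Torus.geometry (Fin 3); let γ := fun z (s : ℝ) => (Φ N).flow s z; let bx : UnitAddTorus (Fin 3) → UnitAddTorus (Fin 3) → ℝ := fun x y => 3 / (Real.pi * r ^ 3) * max (1 - Literature.Analysis.FluidPDE.Torus.euclidDist x y / r) 0; let ρm := fun z s (x₀ : UnitAddTorus (Fin 3)) => ∫ q, bx q.1 x₀ ∂(Literature.Analysis.FluidPDE.empiricalMeasure (γ z s)); let hm := fun z s (x₀ : UnitAddTorus (Fin 3)) (v : EuclideanSpace ℝ (Fin 3)) => ∫ q, bx q.1 x₀ * Literature.Analysis.FluidPDE.localMaxwellian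 1 (ϑ ^ 2) v q.2 ∂(Literature.Analysis.FluidPDE.empiricalMeasure (γ z s)); let pv := fun z s (i j : Fin (N + 1)) => Literature.Analysis.FluidPDE.reflectVel (G.sepVec (γ z s i).1 (γ z s j).1) ((γ z s i).2, (γ z s j).2); let F := fun z s (i j : Fin (N + 1)) => Real.log (hm z s (γ z s i).1 (pv z s i j).1) + Real.log (hm z s (γ z s i).1 (pv z s i j).2) - Real.log (hm z s (γ z s i).1 (γ z s i).2) - Real.log (hm z s (γ z s i).1 (γ z s j).2); let Kc := fun (Fn : Literature.Analysis.FluidPDE.Config (N + 1) (Fin 3) Literature.MathematicalPhysics.KineticTheory.T3 → ℝ → Fin (N + 1) → Fin (N + 1) → ℝ) z => ε / (N + 1 : ℝ) * ∑ᶠ (s : ℝ) (_ : s ∈ Literature.Analysis.FluidPDE.collisionTimes G ε (γ z) ∩ Set.Icc 0 τ), ∑ i : Fin (N + 1), ∑ j : Fin (N + 1), (if i ≠ j ∧ ‖G.sepVec (γ z s i).1 (γ z s j).1‖ = ε then Fn z s i j else 0); let D := fun z => Kc (fun z s i j => χ (s, (γ z s i).1) * g (σ ^ 3 * ρm z s (γ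 z s i).1) * (Ψ (ε⁻¹ • G.sepVec (γ z s i).1 (γ z s j).1, (pv z s i j).1, (pv z s i j).2) * (1 + Real.exp (-F z s i j)))) z; let LG := Literature.MathematicalPhysics.KineticTheory.localGibbsLaw σ (fun _ => abar) (fun _ => 0) (fun _ => θbar) N (Φ N); let S := fun z : Literature.Analysis.FluidPDE.Config (N + 1) (Fin 3) Literature.MathematicalPhysics.KineticTheory.T3 => ∑ i : Fin (N + 1), b (z i); |∫ z, D z * (S z - ∫ z', S z' ∂LG) ∂LG| ≤ η

/-! ## §B  Dilute blow-down and rigidity at the Boltzmann–Grad point (card `dilute-blowdown-chaos-rigidity`) -/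

/-- **The blow-down is available inside the crux.** A threshold statement
`∃ σ₀ > 0, ∀ σ ∈ (0, σ₀), Good σ` (the shape of the crux after `∃ η₀` and the profiles are fixed,
and — one level up — of `∃ η₀` itself, since `Good` is antitone in `η₀`) holds iff there is NO
sequence of bad reduced densities `σ_k → 0⁺`. So a counterexample to `OddContactSymmetry` is never a
single dense gas: it is a family of forward evolutions at `σ_k³ρ → 0` — exactly the data of a
Boltzmann–Grad blow-down (rescale lengths by the mean free path `∝ σ_k⁻²`), on which Lanford-type
compactness and the `φ = 0` rigidity below can act. [folklore] -/
theorem threshold_iff_no_bad_seq (Good : ℝ → Prop) :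
    (∃ σ₀ : ℝ, 0 < σ₀ ∧ ∀ σ : ℝ, 0 < σ → σ < σ₀ → Good σ) ↔
      ¬ ∃ s : ℕ → ℝ, (∀ k, 0 < s k) ∧ Tendsto s atTop (𝓝 0) ∧ ∀ k, ¬ Good (s k) := by
  constructor
  · rintro ⟨σ₀, hσ₀, hgood⟩ ⟨s, hpos, hlim, hbad⟩
    have hev : ∀ᶠ k in atTop, s k < σ₀ := (tendsto_order.1 hlim).2 σ₀ hσ₀
    obtain ⟨k, hk⟩ := hev.exists
    exact hbad k (hgood (s k) (hpos k) hk)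
  · intro hno
    by_contra hth
    push Not at hth
    -- for every k pick a bad σ below 1/(k+1)
    have hpick : ∀ k : ℕ, ∃ σ : ℝ, 0 < σ ∧ σ < 1 / ((k : ℝ) + 1) ∧ ¬ Good σ := by
      intro k
      have hk : (0 : ℝ) < 1 / ((k : ℝ) + 1) := by positivity
      obtain ⟨σ, hσ, hσlt, hbad⟩ := hth (1 / ((k : ℝ) + 1)) hk
      exact ⟨σ, hσ, hσlt, hbad⟩
    choose s hs using hpick
    refine hno ⟨s, fun k => (hs k).1, ?_, fun k => (hs k).2.2⟩
    refine squeeze_zero (fun k => (hs k).1.le) (fun k => (hs k).2.1.le) ?_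
    exact tendsto_one_div_add_atTop_nhds_zero_nat

/-- **Rigidity at the blow-down point (typed target).** Over the tree's Boltzmann hierarchy
(`boltzmannHOp`, the Boltzmann–Grad collision operators `C⁰_{s,s+1}`): let `F^{(s)}` be a spatially
HOMOGENEOUS family on `(ℝ³ × ℝ³)^s` which is (i) a Hewitt–Savage mixture of tensor powers of one-body
velocity densities `h_a`, `a` ranging over a probability space (the de Finetti form of an
exchangeable, position-chaotic translation-invariant state — what a Boltzmann–Grad blow-down of
clustering stationary local limits produces), with (ii) uniform Gaussian (Lanford-class) bounds, and
(iii) STATIONARY for the hierarchy: every collision term vanishes, `C⁰_{s,s+1} F^{(s+1)} = 0` for all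
`s` (free transport acts trivially on homogeneous families, so this is the mild equation with
`F(t) ≡ F(0)`). Then `π`-almost every `h_a` is a Maxwellian. (Proof sketch, M-sized: test level `s`
against `φ₁ ⊗ … ⊗ φ_s`; the identities say that `a ↦ ⟨Q(h_a,h_a), φ⟩` integrates to zero against the
point-separating algebra generated by `a ↦ ⟨h_a, ψ⟩`, hence vanishes `π`-a.e.; `Q(h,h) = 0` forces
`log h` to be a collision invariant — tree `IsCollisionInvariant.exists_eq_quadratic_holds`.)
Spohn 1984 (LNM 1048) / Arkeryd–Caprino–Ianiro 1991 prove the time-dependent analogue (statistical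
solutions of the Boltzmann hierarchy are superpositions of Boltzmann solutions). -/
def HomogeneousHierarchyRigidity : Prop :=
  ∀ (A : Type) [MeasurableSpace A] (pr : Measure A) [IsProbabilityMeasure pr]
    (h : A → V3 → ℝ),
    Measurable (Function.uncurry h) →
    (∀ a v, 0 ≤ h a v) →
    (∃ C β : ℝ, 0 < β ∧ ∀ a v, h a v ≤ C * Real.exp (-β * ‖v‖ ^ 2)) →
    (∀ a, ∫ v, h a v = 1) →
    (let G := Literature.Analysis.FluidPDE.Euclidean.geometry (Fin 3)
     let F : (s : ℕ) → Literature.Analysis.FluidPDE.Config s (Fin 3) V3 → ℝ :=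
       fun s Z => ∫ a, Literature.Analysis.FluidPDE.tensorPow s (fun y => h a y.2) Z ∂pr
     (∀ s (Z : Literature.Analysis.FluidPDE.Config s (Fin 3) V3),
        Literature.Analysis.FluidPDE.boltzmannHOp G s (F (s + 1)) Z = 0) →
     ∀ᵐ a ∂pr, ∃ (ρ θ : ℝ) (u : V3), 0 < θ ∧
       ∀ v, h a v = Literature.Analysis.FluidPDE.localMaxwellian ρ θ u v)

end Summit.AtomisticToContinuum.HydrodynamicLimit.Cruxes.OddContactSymmetry.IdeatorTwoG2
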